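import Mathlib
import HarnessLib
import Summits.HubbardSuperconductivity.HubbardSuperconductivity.Theorems.KLProgrammeC4aSliceIncrementAssembly
import Summits.HubbardSuperconductivity.HubbardSuperconductivity.Theorems.KLProgrammeKLRegimeSplitSlotsV17F

/-!
# Route `KLProgramme`, crux K3 — gen-8 ENGINE-FLOW child (stmt-HubbardSuperconductivity-20437 `KLRegimeEngineV17F2`), stub (C)
# `stub_twoLeg_curvature`, v2 text: «(A)-OSC ADAPTER» — the STRUCTURED value of the slice increment `δ_{n+1}(K)` (θ-free constant + `U²16^{−(n+1)}`
# remainder) in the (A) capstone's own currency, i.e. the `hAval` input of `twoLegReadPriv_flow_succ`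

Seat hubbard-kl-k3c3-p1 (g11; row «δμ-flow with klAngularMean constant piece»).  The Osc conjunct `TwoLegReadOscAt` of stub (C) v2 is assembled per scale
(`…FlowReadResidueOsc`, `…FlowReadPrivStep`) from ONE structured estimate of the (A) increment at the new frame,
`|δ_{n+1}(K_{n+1})(θ) − τ_A| ≤ a·U²·4^{−2(n+1)}` («(A)-OSC», KL STATUS l.4548), plus the three residue doors.  c4a-1's capstone
`twoLegCurveJetBound_succ_of_inputs(_value)` (…C4aSliceIncrementAssembly) reads the profile as `δ_{n+1}(K) = avg8 F`,
`F = θ ↦ Re[tadpoleCont + localReadingCont R₁ + localReadingCont R₂](k_F^K θ)` (`klTwoLegCurveProfile_succ_eq_avg8`), and feeds the `k = 0` line with a plain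
sup `V₀` of the one-line term.  This file is the structured twin of that `k = 0` line, so that «(A)-OSC» is delivered by the SAME inputs plus c4a-1's
Hartree split of the one-line value (§17.5/§22.5 of C4A-PLAN: the bare tadpole vertex is the θ-blind constant `−U/(β²L²)`, `tubeTadpole_const_vertex`):

* §1 `avg8` reproduces constants: `avg8_const`, `avg8_sub_const`, `abs_avg8_le_of_abs_le`, **`abs_avg8_sub_const_le`** (`|F − τ| ≤ b` everywhere ⇒
  `|avg8 F − τ| ≤ b` everywhere) — the eight-image average is an average;
* §2 **`abs_klTwoLegCurveProfile_succ_sub_const_le_of_pointwise`** — at any frame `K` (`Z^K_{Λ_n} ≠ 0`): a pointwise structured bound on `Re T ∘ k_F^K`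
  transfers verbatim to `δ_{n+1}(K)`;
* §3 **`abs_klTwoLegCurveProfile_succ_sub_const_le_of_inputs`** — «(A)-OSC» from the capstone's inputs: the structured one-line value
  `|Re tadpoleCont(k_F^K θ) − τ| ≤ aT` (c4a-1's (L3-val) with the Hartree constant subtracted instead of bounded), the two remainder VALUE rows in their
  `bell4 (twoPointMoment β R) D 0` currency (`abs_iteratedDeriv_re_localReadingCont_klFermiPoint_le` at `j = 0`), and one fit
  `aT + bell4(M(R₁)) D 0 + bell4(M(R₂)) D 0 ≤ a·U²·4^{−2(n+1)}` ⟹ `∀ θ, |δ_{n+1}(K)(θ) − τ| ≤ a·U²·4^{−2(n+1)}`;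
  **`…_flow`** — the instance at the flow frame `K := klFlowFrameU L M β U μ (n+1)`: LITERALLY the `hAval` hypothesis of `twoLegReadPriv_flow_succ`.

Calculus + bookkeeping; every analytic input is a named hypothesis of c4a-1's lane; nothing here asserts any stub of 20437, K3 or superconductivity.
References: BGM 2006 §2.4 (2.36)–(2.40) [cite: BenfattoGiulianiMastropietro2006].
-/

noncomputable section

namespace Summit.HubbardSuperconductivity.HubbardSuperconductivity.Theorems.C4a

set_option linter.dupNamespace false -- summit = problem name (single-conjunct summit), D-0017

open Real Set MeasureTheory Finset
open scoped ContDiff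
open Literature.MathematicalPhysics.QuantumLattice Literature.MathematicalPhysics.QuantumLattice.BandSectorCounting Literature.Probability.LatticeModels
open GrassmannAlgebra
open Summit.HubbardSuperconductivity.HubbardSuperconductivity.Theorems.KLRegimeSplit
open Summit.HubbardSuperconductivity.HubbardSuperconductivity.Theorems.KLProgrammeLegKernels
open Summit.HubbardSuperconductivity.HubbardSuperconductivity.Theorems.KLRegimeWick
open Summit.HubbardSuperconductivity.HubbardSuperconductivity.Theorems.DispersionFlow
open Summit.HubbardSuperconductivity.HubbardSuperconductivity.Theorems.PerturbedFermiCurve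

/-! ## §1 The eight-image average reproduces constants -/

/-- `avg8` of a constant is the constant. -/
theorem avg8_const (τ : ℝ) : avg8 (fun _ => τ) = fun _ => τ := by
  funext θ; simp only [avg8]; ring

/-- Subtracting a constant commutes with `avg8`: `avg8 F θ − τ = avg8 (F − τ) θ`. -/
theorem avg8_sub_const (F : ℝ → ℝ) (τ θ : ℝ) : avg8 F θ - τ = avg8 (fun θ' => F θ' - τ) θ := by
  simp only [avg8]; ring

/-- A uniform sup bound transfers through `avg8` (order `0` of `abs_iteratedDeriv_avg8_le`, with no smoothness needed). -/
theorem abs_avg8_le_of_abs_le {F : ℝ → ℝ} {b : ℝ} (hb : ∀ θ : ℝ, |F θ| ≤ b) (θ : ℝ) : |avg8 F θ| ≤ b := by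
  rw [avg8_eq_sum, abs_div, abs_of_pos (by norm_num : (0 : ℝ) < 8), div_le_iff₀ (by norm_num : (0 : ℝ) < 8)]
  calc |∑ i : Fin 8, F (avg8Sign i * θ + avg8Shift i)| ≤ ∑ i : Fin 8, |F (avg8Sign i * θ + avg8Shift i)| := Finset.abs_sum_le_sum_abs _ _
    _ ≤ ∑ _i : Fin 8, b := Finset.sum_le_sum fun i _ => hb _
    _ = b * 8 := by simp [mul_comm]

/-- **STRUCTURED TRANSFER**: `|F(θ) − τ| ≤ b` everywhere ⟹ `|avg8 F (θ) − τ| ≤ b` everywhere. -/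
theorem abs_avg8_sub_const_le {F : ℝ → ℝ} {τ b : ℝ} (hb : ∀ θ : ℝ, |F θ - τ| ≤ b) (θ : ℝ) : |avg8 F θ - τ| ≤ b := by
  rw [avg8_sub_const]; exact abs_avg8_le_of_abs_le hb θ

/-! ## §2 The increment profile at a fixed frame: pointwise structured bound ⟹ structured bound -/

section Model

variable {L M : ℕ} [NeZero L] [NeZero M] {K : TrigPolyC4v} {μ : ℝ}

/-- **The structured value of `δ_{n+1}(K)` from a pointwise structured bound on its generating function** (`Z^K_{Λ_n} ≠ 0`; `T` = the increment
reading `tadpoleCont + localReadingCont R₁ + localReadingCont R₂` of `klTwoLegCurveProfile_succ_eq_avg8`). -/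
theorem abs_klTwoLegCurveProfile_succ_sub_const_le_of_pointwise {β : ℝ} (hβ : β ≠ 0) (U : ℝ) (n : ℕ)
    (hZ : hubbardEffPartitionFnCT L M β U μ 0 K (klScale klE0 n) ≠ 0) {T : (Fin 2 → ℝ) → ℂ}
    (hT : T = fun P =>
      tadpoleCont β μ K (klScale klE0 (n + 1)) (klScale klE0 n) (klEffectiveAction L M β U μ K klE0 n) P +
        localReadingCont β
          (gaussConv ℂ (hubbardCovSliceCT L M β μ 0 K (klScale klE0 (n + 1)) (klScale klE0 n)) (klEffectiveAction L M β U μ K klE0 n) -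
            klEffectiveAction L M β U μ K klE0 n -
            grassmannLaplacian ℂ (hubbardCovSliceCT L M β μ 0 K (klScale klE0 (n + 1)) (klScale klE0 n))
              (klEffectiveAction L M β U μ K klE0 n)) P +
        localReadingCont β
          (effAction ℂ (hubbardCovSliceCT L M β μ 0 K (klScale klE0 (n + 1)) (klScale klE0 n)) (klEffectiveAction L M β U μ K klE0 n) -
            gaussConv ℂ (hubbardCovSliceCT L M β μ 0 K (klScale klE0 (n + 1)) (klScale klE0 n)) (klEffectiveAction L M β U μ K klE0 n)) P)
    {τ b : ℝ} (hb : ∀ θ' : ℝ, |(T (klFermiPoint μ K θ')).re - τ| ≤ b) (θ : ℝ) :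
    |klTwoLegCurveProfile L M β U μ K (n + 1) θ - τ| ≤ b := by
  rw [klTwoLegCurveProfile_succ_eq_avg8 hβ U n hZ hT θ]
  exact abs_avg8_sub_const_le hb θ

/-! ## §3 «(A)-OSC» from the capstone's inputs -/

/-- **«(A)-OSC» — THE STRUCTURED VALUE OF THE SLICE INCREMENT FROM NAMED INPUTS** (the `k = 0` line of `twoLegCurveJetBound_succ_of_inputs_value`,
structured): with the one-line value within `aT` of a θ-free constant `τ` (the Hartree part subtracted — c4a-1's `tubeTadpole_const_vertex` split), the two
remainder readings' value rows in `bell4 (twoPointMoment β R) D 0` currency, and `aT + bell4(M(R₁)) D 0 + bell4(M(R₂)) D 0 ≤ a·U²·4^{−2(n+1)}`: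
`|δ_{n+1}(K)(θ) − τ| ≤ a·U²·4^{−2(n+1)}` at every angle. -/
theorem abs_klTwoLegCurveProfile_succ_sub_const_le_of_inputs {β : ℝ} (hβ : β ≠ 0) (U : ℝ) (n : ℕ)
    (hZ : hubbardEffPartitionFnCT L M β U μ 0 K (klScale klE0 n) ≠ 0)
    (hγ : ContDiff ℝ 4 fun θ : ℝ => (WithLp.toLp 2 (klFermiPoint μ K θ) : Momentum)) {D : ℕ → ℝ}
    (hD : ∀ θ : ℝ, ∀ i, 1 ≤ i → i ≤ 4 → ‖iteratedDeriv i (fun θ : ℝ => (WithLp.toLp 2 (klFermiPoint μ K θ) : Momentum)) θ‖ ≤ D i)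
    -- the structured one-line value
    {τ aT : ℝ} (hV₀ : ∀ θ : ℝ,
      |(tadpoleCont β μ K (klScale klE0 (n + 1)) (klScale klE0 n) (klEffectiveAction L M β U μ K klE0 n) (klFermiPoint μ K θ)).re - τ| ≤ aT)
    {a : ℝ}
    (hfit0 : aT +
        bell4 (twoPointMoment β
          (gaussConv ℂ (hubbardCovSliceCT L M β μ 0 K (klScale klE0 (n + 1)) (klScale klE0 n)) (klEffectiveAction L M β U μ K klE0 n) -
            klEffectiveAction L M β U μ K klE0 n -
            grassmannLaplacian ℂ (hubbardCovSliceCT L M β μ 0 K (klScale klE0 (n + 1)) (klScale klE0 n))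
              (klEffectiveAction L M β U μ K klE0 n))) D 0 +
        bell4 (twoPointMoment β
          (effAction ℂ (hubbardCovSliceCT L M β μ 0 K (klScale klE0 (n + 1)) (klScale klE0 n)) (klEffectiveAction L M β U μ K klE0 n) -
            gaussConv ℂ (hubbardCovSliceCT L M β μ 0 K (klScale klE0 (n + 1)) (klScale klE0 n)) (klEffectiveAction L M β U μ K klE0 n))) D 0 ≤
      a * U ^ 2 * (4 : ℝ) ^ (-2 * ((n + 1 : ℕ) : ℤ))) (θ : ℝ) :
    |klTwoLegCurveProfile L M β U μ K (n + 1) θ - τ| ≤ a * U ^ 2 * (4 : ℝ) ^ (-2 * ((n + 1 : ℕ) : ℤ)) := by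
  set R₁ : HubbardGrassmann L M :=
    gaussConv ℂ (hubbardCovSliceCT L M β μ 0 K (klScale klE0 (n + 1)) (klScale klE0 n)) (klEffectiveAction L M β U μ K klE0 n) -
      klEffectiveAction L M β U μ K klE0 n -
      grassmannLaplacian ℂ (hubbardCovSliceCT L M β μ 0 K (klScale klE0 (n + 1)) (klScale klE0 n)) (klEffectiveAction L M β U μ K klE0 n) with hR₁
  set R₂ : HubbardGrassmann L M :=
    effAction ℂ (hubbardCovSliceCT L M β μ 0 K (klScale klE0 (n + 1)) (klScale klE0 n)) (klEffectiveAction L M β U μ K klE0 n) -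
      gaussConv ℂ (hubbardCovSliceCT L M β μ 0 K (klScale klE0 (n + 1)) (klScale klE0 n)) (klEffectiveAction L M β U μ K klE0 n) with hR₂
  refine abs_klTwoLegCurveProfile_succ_sub_const_le_of_pointwise hβ U n hZ rfl (fun θ' => ?_) θ
  -- the two remainder value rows, read at order `0`
  have h1 := abs_iteratedDeriv_re_localReadingCont_klFermiPoint_le β μ K R₁ hγ (hD θ') (j := 0) (by norm_num)
  have h2 := abs_iteratedDeriv_re_localReadingCont_klFermiPoint_le β μ K R₂ hγ (hD θ') (j := 0) (by norm_num)
  simp only [iteratedDeriv_zero] at h1 h2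
  have h0 := hV₀ θ'
  simp only [Complex.add_re]
  rw [show ∀ x y z : ℝ, x + y + z - τ = (x - τ) + y + z from fun x y z => by ring]
  refine le_trans ((abs_add_le _ _).trans (add_le_add ((abs_add_le _ _).trans (add_le_add h0 h1)) h2)) ?_
  simpa only [hR₁, hR₂] using hfit0

/-- **«(A)-OSC» AT THE FLOW FRAME** `K := klFlowFrameU L M β U μ (n+1)`: LITERALLY the `hAval` hypothesis of `twoLegReadPriv_flow_succ`
(…FlowReadPrivStep) — `∀ θ, |klTwoLegCurveProfile L M β U μ K_{n+1} (n+1) θ − τ| ≤ a·U²·4^{−2(n+1)}`. -/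
theorem abs_klTwoLegCurveProfile_succ_sub_const_le_of_inputs_flow {β U : ℝ} (hβ : β ≠ 0) (n : ℕ)
    (hZ : hubbardEffPartitionFnCT L M β U μ 0 (klFlowFrameU L M β U μ (n + 1)) (klScale klE0 n) ≠ 0)
    (hγ : ContDiff ℝ 4 fun θ : ℝ => (WithLp.toLp 2 (klFermiPoint μ (klFlowFrameU L M β U μ (n + 1)) θ) : Momentum)) {D : ℕ → ℝ}
    (hD : ∀ θ : ℝ, ∀ i, 1 ≤ i → i ≤ 4 →
      ‖iteratedDeriv i (fun θ : ℝ => (WithLp.toLp 2 (klFermiPoint μ (klFlowFrameU L M β U μ (n + 1)) θ) : Momentum)) θ‖ ≤ D i)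
    {τ aT : ℝ} (hV₀ : ∀ θ : ℝ,
      |(tadpoleCont β μ (klFlowFrameU L M β U μ (n + 1)) (klScale klE0 (n + 1)) (klScale klE0 n)
        (klEffectiveAction L M β U μ (klFlowFrameU L M β U μ (n + 1)) klE0 n) (klFermiPoint μ (klFlowFrameU L M β U μ (n + 1)) θ)).re - τ| ≤ aT)
    {a : ℝ}
    (hfit0 : aT +
        bell4 (twoPointMoment β
          (gaussConv ℂ (hubbardCovSliceCT L M β μ 0 (klFlowFrameU L M β U μ (n + 1)) (klScale klE0 (n + 1)) (klScale klE0 n))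
              (klEffectiveAction L M β U μ (klFlowFrameU L M β U μ (n + 1)) klE0 n) -
            klEffectiveAction L M β U μ (klFlowFrameU L M β U μ (n + 1)) klE0 n -
            grassmannLaplacian ℂ (hubbardCovSliceCT L M β μ 0 (klFlowFrameU L M β U μ (n + 1)) (klScale klE0 (n + 1)) (klScale klE0 n))
              (klEffectiveAction L M β U μ (klFlowFrameU L M β U μ (n + 1)) klE0 n))) D 0 +
        bell4 (twoPointMoment β
          (effAction ℂ (hubbardCovSliceCT L M β μ 0 (klFlowFrameU L M β U μ (n + 1)) (klScale klE0 (n + 1)) (klScale klE0 n))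
              (klEffectiveAction L M β U μ (klFlowFrameU L M β U μ (n + 1)) klE0 n) -
            gaussConv ℂ (hubbardCovSliceCT L M β μ 0 (klFlowFrameU L M β U μ (n + 1)) (klScale klE0 (n + 1)) (klScale klE0 n))
              (klEffectiveAction L M β U μ (klFlowFrameU L M β U μ (n + 1)) klE0 n))) D 0 ≤
      a * U ^ 2 * (4 : ℝ) ^ (-2 * ((n + 1 : ℕ) : ℤ))) :
    ∀ θ : ℝ, |klTwoLegCurveProfile L M β U μ (klFlowFrameU L M β U μ (n + 1)) (n + 1) θ - τ| ≤
      a * U ^ 2 * (4 : ℝ) ^ (-2 * ((n + 1 : ℕ) : ℤ)) :=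
  fun θ => abs_klTwoLegCurveProfile_succ_sub_const_le_of_inputs hβ U n hZ hγ hD hV₀ hfit0 θ

end Model

end Summit.HubbardSuperconductivity.HubbardSuperconductivity.Theorems.C4a

end
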